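import Mathlib.Analysis.Calculus.ContDiff.Bounds
import Mathlib.Analysis.Calculus.Deriv.Inv
import Mathlib.Analysis.SpecialFunctions.ExpDeriv
import Mathlib.Data.Nat.Choose.Sum
import HarnessLib

/-!
# Leibniz recursions for the derivatives of `exp (-J)` and `(1 + δ m)⁻¹`

Analysis/Calculus support file (everything proved, theorems only). Bounds for the iterated
Fréchet derivatives of the two nonlinear compositions met in Duhamel formulas for kinetic
equations with absorption and mass normalisation — the absorption factor `e^{-J}` and the
normalising factor `(1 + δ m)⁻¹` — in the form needed to run *linear* Grönwall recursions on the
highest derivative: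

* `sum_choose_mul_le`, `sum_choose_mul_le_ends` — the Leibniz sums
  `∑ᵢ C(n,i) xᵢ y_{n-i}` are `≤ 2ⁿ X Y`, and `≤ x₀ yₙ + xₙ y₀ + 2ⁿ X' Y'` with `X', Y'` bounding
  only the intermediate orders (so that the two top orders enter linearly);
* `norm_iteratedFDeriv_succ_le_of_fderiv_eq_smul` — if `DΦ = ψ • DJ` then
  `‖Dⁿ⁺¹Φ‖ ≤ ∑ᵢ C(n,i) ‖Dⁱψ‖ ‖Dⁿ⁺¹⁻ⁱJ‖` (Leibniz, pointwise);
* `norm_iteratedFDeriv_exp_neg_le` (crude: `‖Dⁱ e^{-J}‖ ≤ (2ⁱ S)ⁱ` when `J ≥ 0` and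
  `‖DˡJ‖ ≤ S`, `S ≥ 1`) and `norm_iteratedFDeriv_exp_neg_succ_le` (refined:
  `‖Dⁿ⁺¹ e^{-J}‖ ≤ ‖Dⁿ⁺¹J‖ + 2ⁿ S (2ⁿ S)ⁿ`, linear in the top order);
* `norm_iteratedFDeriv_inv_one_add_le` (crude: `‖Dⁱ (1 + δ m)⁻¹‖ ≤ Θ^(2ⁱ - 1)`,
  `Θ = 4ⁿ max(δ,1) S`, for `m ≥ 0`) and `norm_iteratedFDeriv_inv_one_add_succ_le` (refined:
  `‖Dⁿ⁺¹ (1 + δ m)⁻¹‖ ≤ δ ‖Dⁿ⁺¹ m‖ + 4ⁿ δ S Θ^(2ⁿ⁺¹ - 2)`).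

All bounds are pointwise (hypotheses and conclusions at one point), as Mathlib's
`norm_iteratedFDeriv_mul_le` / `norm_iteratedFDeriv_smul_le`, on which they rest. The constants
are crude by design; only the affine dependence on the top-order derivative matters downstream.

## Mathlib search

`norm_iteratedFDeriv_comp_le` (Faà di Bruno bound `n! C Dⁿ`, geometric hypothesis `‖Dⁱf‖ ≤ Dⁱ`,
not affine in the top order), `norm_iteratedFDeriv_mul_le`, `norm_iteratedFDeriv_smul_le`,
`Nat.sum_range_choose`.

## References

* H. Cartan, *Calcul différentiel* (1967), §I.5 (Leibniz formula for higher derivatives).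
-/

noncomputable section

open Set Function Finset
open scoped ContDiff

namespace Literature.Analysis.Calculus

/-! ### Leibniz sums -/

/-- Crude bound for a Leibniz sum: `∑ᵢ C(n,i) xᵢ y_{n-i} ≤ 2ⁿ X Y` when `0 ≤ xᵢ ≤ X`,
`0 ≤ yᵢ ≤ Y`. [folklore] -/
theorem sum_choose_mul_le {x y : ℕ → ℝ} {n : ℕ} {X Y : ℝ} (hx : ∀ i ≤ n, 0 ≤ x i)
    (hX : ∀ i ≤ n, x i ≤ X) (hy : ∀ i ≤ n, 0 ≤ y i) (hY : ∀ i ≤ n, y i ≤ Y) :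
    ∑ i ∈ range (n + 1), (n.choose i : ℝ) * x i * y (n - i) ≤ 2 ^ n * X * Y := by
  have hX0 : 0 ≤ X := (hx 0 (Nat.zero_le _)).trans (hX 0 (Nat.zero_le _))
  calc ∑ i ∈ range (n + 1), (n.choose i : ℝ) * x i * y (n - i)
      ≤ ∑ i ∈ range (n + 1), (n.choose i : ℝ) * X * Y := by
        refine sum_le_sum fun i hi => ?_
        have hin : i ≤ n := Nat.lt_succ_iff.1 (mem_range.1 hi)
        have h1 : x i * y (n - i) ≤ X * Y :=
          mul_le_mul (hX i hin) (hY _ (Nat.sub_le _ _)) (hy _ (Nat.sub_le _ _)) hX0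
        have h2 : (0 : ℝ) ≤ n.choose i := Nat.cast_nonneg _
        calc (n.choose i : ℝ) * x i * y (n - i) = (n.choose i : ℝ) * (x i * y (n - i)) := by ring
          _ ≤ (n.choose i : ℝ) * (X * Y) := mul_le_mul_of_nonneg_left h1 h2
          _ = _ := by ring
    _ = (∑ i ∈ range (n + 1), (n.choose i : ℝ)) * X * Y := by rw [sum_mul, sum_mul]
    _ = 2 ^ n * X * Y := by
        congr 1
        congr 1
        have h := Nat.sum_range_choose n
        exact_mod_cast h

/-- Refined bound for a Leibniz sum, the two extreme orders kept apart:
`∑ᵢ C(n,i) xᵢ y_{n-i} ≤ x₀ yₙ + xₙ y₀ + 2ⁿ X' Y'` when all terms are nonnegative and `X', Y' ≥ 0`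
bound `xᵢ`, `yᵢ` for the intermediate orders `1 ≤ i < n` only. [folklore] -/
theorem sum_choose_mul_le_ends {x y : ℕ → ℝ} {n : ℕ} {X Y : ℝ} (hx : ∀ i ≤ n, 0 ≤ x i)
    (hy : ∀ i ≤ n, 0 ≤ y i) (hX0 : 0 ≤ X) (hY0 : 0 ≤ Y) (hX : ∀ i, 1 ≤ i → i < n → x i ≤ X)
    (hY : ∀ i, 1 ≤ i → i < n → y i ≤ Y) :
    ∑ i ∈ range (n + 1), (n.choose i : ℝ) * x i * y (n - i) ≤
      x 0 * y n + x n * y 0 + 2 ^ n * X * Y := by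
  -- termwise domination by `[i = 0] x₀yₙ + [i = n] xₙy₀ + C(n,i) X Y`
  set f : ℕ → ℝ := fun i => (if i = 0 then x 0 * y n else 0) + (if i = n then x n * y 0 else 0) +
    (n.choose i : ℝ) * X * Y with hf
  have hterm : ∀ i ∈ range (n + 1), (n.choose i : ℝ) * x i * y (n - i) ≤ f i := by
    intro i hi
    have hin : i ≤ n := Nat.lt_succ_iff.1 (mem_range.1 hi)
    have hC : (0 : ℝ) ≤ (n.choose i : ℝ) * X * Y := by positivity
    have hA : 0 ≤ x 0 * y n := mul_nonneg (hx 0 (Nat.zero_le _)) (hy n le_rfl)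
    have hB : 0 ≤ x n * y 0 := mul_nonneg (hx n le_rfl) (hy 0 (Nat.zero_le _))
    simp only [hf]
    by_cases hi0 : i = 0
    · subst hi0
      simp only [Nat.choose_zero_right, Nat.cast_one, one_mul, Nat.sub_zero, if_true]
      split_ifs <;> nlinarith
    · by_cases hin' : i = n
      · subst hin'
        simp only [Nat.choose_self, Nat.cast_one, one_mul, Nat.sub_self, if_true, hi0, if_false,
          zero_add]
        nlinarith
      · have h1 : 1 ≤ i := Nat.one_le_iff_ne_zero.2 hi0
        have h2 : i < n := lt_of_le_of_ne hin hin'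
        have h3 : 1 ≤ n - i := Nat.le_sub_of_add_le' h2
        have h4 : n - i < n := Nat.sub_lt (lt_of_le_of_lt (Nat.zero_le _) h2) (by omega)
        simp only [hi0, hin', if_false, zero_add]
        have h5 : x i * y (n - i) ≤ X * Y :=
          mul_le_mul (hX i h1 h2) (hY _ h3 h4) (hy _ (Nat.sub_le _ _)) hX0
        calc (n.choose i : ℝ) * x i * y (n - i) = (n.choose i : ℝ) * (x i * y (n - i)) := by ring
          _ ≤ (n.choose i : ℝ) * (X * Y) := mul_le_mul_of_nonneg_left h5 (Nat.cast_nonneg _)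
          _ = _ := by ring
  calc ∑ i ∈ range (n + 1), (n.choose i : ℝ) * x i * y (n - i) ≤ ∑ i ∈ range (n + 1), f i :=
        sum_le_sum hterm
    _ = x 0 * y n + x n * y 0 + 2 ^ n * X * Y := by
        simp only [hf, sum_add_distrib]
        have hn0 : (0 : ℕ) ∈ range (n + 1) := mem_range.2 (Nat.succ_pos n)
        have hnn : n ∈ range (n + 1) := mem_range.2 (Nat.lt_succ_self n)
        rw [sum_ite_eq' (range (n + 1)) 0, if_pos hn0, sum_ite_eq' (range (n + 1)) n, if_pos hnn]
        congr 1
        rw [← sum_mul, ← sum_mul]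
        congr 1
        congr 1
        exact_mod_cast Nat.sum_range_choose n

/-- Head form: if `t₀ ≤ a` and `tᵢ ≤ C(n,i) K` for `1 ≤ i ≤ n` (`K ≥ 0`), then
`∑_{i ≤ n} tᵢ ≤ a + 2ⁿ K`. [folklore] -/
theorem sum_range_succ_le_head_add {t : ℕ → ℝ} {n : ℕ} {a K : ℝ} (hK : 0 ≤ K) (h0 : t 0 ≤ a)
    (h : ∀ i, 1 ≤ i → i ≤ n → t i ≤ (n.choose i : ℝ) * K) :
    ∑ i ∈ range (n + 1), t i ≤ a + 2 ^ n * K := by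
  rw [sum_range_succ']
  have h1 : ∑ i ∈ range n, t (i + 1) ≤ ∑ i ∈ range n, (n.choose (i + 1) : ℝ) * K :=
    sum_le_sum fun i hi => h (i + 1) (Nat.le_add_left _ _) (mem_range.1 hi)
  have h2 : ∑ i ∈ range n, (n.choose (i + 1) : ℝ) * K ≤ 2 ^ n * K := by
    rw [← sum_mul]
    refine mul_le_mul_of_nonneg_right ?_ hK
    have h3 : ∑ i ∈ range n, (n.choose (i + 1) : ℝ) ≤ ∑ i ∈ range (n + 1), (n.choose i : ℝ) := by
      rw [sum_range_succ' (fun i => (n.choose i : ℝ))]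
      simp
    refine h3.trans (le_of_eq ?_)
    exact_mod_cast Nat.sum_range_choose n
  linarith

/-! ### The one-step Leibniz recursion -/

variable {P : Type*} [NormedAddCommGroup P] [NormedSpace ℝ P]

/-- **One-step Leibniz recursion.** If `Φ, ψ, J` are smooth real functions with
`DΦ(z) = ψ(z) • DJ(z)` everywhere, then for every `n` and `z`,
`‖Dⁿ⁺¹Φ(z)‖ ≤ ∑ᵢ C(n,i) ‖Dⁱψ(z)‖ ‖Dⁿ⁺¹⁻ⁱJ(z)‖`. [folklore] -/
theorem norm_iteratedFDeriv_succ_le_of_fderiv_eq_smul {Φ ψ J : P → ℝ} (hψ : ContDiff ℝ ∞ ψ)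
    (hJ : ContDiff ℝ ∞ J) (hD : ∀ z, fderiv ℝ Φ z = ψ z • fderiv ℝ J z) (n : ℕ) (z : P) :
    ‖iteratedFDeriv ℝ (n + 1) Φ z‖ ≤ ∑ i ∈ range (n + 1),
      (n.choose i : ℝ) * ‖iteratedFDeriv ℝ i ψ z‖ * ‖iteratedFDeriv ℝ (n + 1 - i) J z‖ := by
  have hJ' : ContDiff ℝ ∞ (fderiv ℝ J) := (contDiff_infty_iff_fderiv.1 hJ).2
  have heq : fderiv ℝ Φ = fun z => ψ z • fderiv ℝ J z := funext hD
  rw [← norm_iteratedFDeriv_fderiv, heq]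
  refine (norm_iteratedFDeriv_smul_le hψ hJ' z (mod_cast le_top)).trans (le_of_eq ?_)
  refine sum_congr rfl fun i hi => ?_
  have hin : i ≤ n := Nat.lt_succ_iff.1 (mem_range.1 hi)
  rw [norm_iteratedFDeriv_fderiv, Nat.sub_add_comm hin]

/-! ### The absorption factor `exp (-J)` -/

section Exp

variable {J : P → ℝ}

/-- The derivative of `e^{-J}` is `(-e^{-J}) • DJ`. [folklore] -/
theorem fderiv_exp_neg (hJ : ContDiff ℝ ∞ J) (z : P) :
    fderiv ℝ (fun z => Real.exp (-J z)) z = (-Real.exp (-J z)) • fderiv ℝ J z := by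
  have hd : HasFDerivAt J (fderiv ℝ J z) z := (hJ.differentiable (by simp) z).hasFDerivAt
  have h2 : HasFDerivAt (fun z => Real.exp (-J z)) (Real.exp (-J z) • -fderiv ℝ J z) z :=
    hd.neg.exp
  rw [h2.fderiv, smul_neg, neg_smul]

/-- `e^{-J}` is smooth. [folklore] -/
theorem contDiff_exp_neg (hJ : ContDiff ℝ ∞ J) : ContDiff ℝ ∞ fun z => Real.exp (-J z) :=
  Real.contDiff_exp.comp hJ.neg

/-- One-step recursion for `e^{-J}`:
`‖Dⁿ⁺¹e^{-J}(z)‖ ≤ ∑ᵢ C(n,i) ‖Dⁱe^{-J}(z)‖ ‖Dⁿ⁺¹⁻ⁱJ(z)‖`. [folklore] -/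
theorem norm_iteratedFDeriv_exp_neg_succ_le_sum (hJ : ContDiff ℝ ∞ J) (n : ℕ) (z : P) :
    ‖iteratedFDeriv ℝ (n + 1) (fun z => Real.exp (-J z)) z‖ ≤ ∑ i ∈ range (n + 1),
      (n.choose i : ℝ) * ‖iteratedFDeriv ℝ i (fun z => Real.exp (-J z)) z‖ *
        ‖iteratedFDeriv ℝ (n + 1 - i) J z‖ := by
  have hE := contDiff_exp_neg hJ
  have h := norm_iteratedFDeriv_succ_le_of_fderiv_eq_smul (Φ := fun z => Real.exp (-J z))
    hE.neg hJ (fun z => by rw [fderiv_exp_neg hJ]) n z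
  refine h.trans (le_of_eq (sum_congr rfl fun i _ => ?_))
  rw [show (fun x => -Real.exp (-J x)) = -fun x => Real.exp (-J x) from rfl,
    iteratedFDeriv_neg_apply, norm_neg]

/-- **Crude bound for the derivatives of `e^{-J}`.** If `J(z) ≥ 0` and `‖DˡJ(z)‖ ≤ S` for
`1 ≤ l ≤ n` with `S ≥ 1`, then `‖Dⁱe^{-J}(z)‖ ≤ (2ⁱ S)ⁱ` for all `i ≤ n`. [folklore] -/
theorem norm_iteratedFDeriv_exp_neg_le (hJ : ContDiff ℝ ∞ J) {z : P} (hJ0 : 0 ≤ J z) {n : ℕ}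
    {S : ℝ} (hS : 1 ≤ S) (hb : ∀ l, 1 ≤ l → l ≤ n → ‖iteratedFDeriv ℝ l J z‖ ≤ S) :
    ∀ i ≤ n, ‖iteratedFDeriv ℝ i (fun z => Real.exp (-J z)) z‖ ≤ (2 ^ i * S) ^ i := by
  have hS0 : 0 ≤ S := zero_le_one.trans hS
  -- strong induction, carried as a statement about all `j ≤ i`
  suffices H : ∀ i ≤ n, ∀ j ≤ i, ‖iteratedFDeriv ℝ j (fun z => Real.exp (-J z)) z‖ ≤
      (2 ^ i * S) ^ i from fun i hi => H i hi i le_rfl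
  intro i
  induction i with
  | zero =>
    intro _ j hj
    rw [Nat.le_zero.1 hj, norm_iteratedFDeriv_zero, Real.norm_eq_abs, abs_of_pos (Real.exp_pos _),
      pow_zero]
    exact Real.exp_le_one_iff.2 (neg_nonpos.2 hJ0)
  | succ i ih =>
    intro hi j hj
    have hi' : i ≤ n := (Nat.le_succ i).trans hi
    have h1 : (1 : ℝ) ≤ 2 ^ i * S := one_le_mul_of_one_le_of_one_le (one_le_pow₀ (by norm_num)) hS
    have h2 : (2 : ℝ) ^ i * S ≤ 2 ^ (i + 1) * S :=
      mul_le_mul_of_nonneg_right (pow_le_pow_right₀ one_le_two (Nat.le_succ i)) hS0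
    have hpow : (2 ^ i * S) ^ i ≤ (2 ^ (i + 1) * S) ^ (i + 1) :=
      calc (2 ^ i * S) ^ i ≤ (2 ^ (i + 1) * S) ^ i := pow_le_pow_left₀ (by positivity) h2 i
        _ ≤ (2 ^ (i + 1) * S) ^ (i + 1) := pow_le_pow_right₀ (h1.trans h2) (Nat.le_succ i)
    rcases Nat.lt_or_ge j (i + 1) with hlt | hge
    · exact (ih hi' j (Nat.lt_succ_iff.1 hlt)).trans hpow
    · have hji : j = i + 1 := le_antisymm hj hge
      subst hji
      refine (norm_iteratedFDeriv_exp_neg_succ_le_sum hJ i z).trans ?_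
      have hsum := sum_choose_mul_le (n := i) (x := fun j => ‖iteratedFDeriv ℝ j
        (fun z => Real.exp (-J z)) z‖) (y := fun j => ‖iteratedFDeriv ℝ (j + 1) J z‖)
        (X := (2 ^ i * S) ^ i) (Y := S) (fun j _ => norm_nonneg _) (fun j hj => ih hi' j hj)
        (fun j _ => norm_nonneg _) (fun j hj => hb (j + 1) (Nat.le_add_left _ _) (by omega))
      have hrw : ∀ j ∈ range (i + 1), (i.choose j : ℝ) * ‖iteratedFDeriv ℝ j
          (fun z => Real.exp (-J z)) z‖ * ‖iteratedFDeriv ℝ (i + 1 - j) J z‖ =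
          (i.choose j : ℝ) * ‖iteratedFDeriv ℝ j (fun z => Real.exp (-J z)) z‖ *
            ‖iteratedFDeriv ℝ (i - j + 1) J z‖ := by
        intro j hj
        rw [Nat.sub_add_comm (Nat.lt_succ_iff.1 (mem_range.1 hj))]
      rw [sum_congr rfl hrw]
      refine hsum.trans ?_
      calc (2 : ℝ) ^ i * (2 ^ i * S) ^ i * S = (2 ^ i * S) ^ (i + 1) := by ring
        _ ≤ (2 ^ (i + 1) * S) ^ (i + 1) := pow_le_pow_left₀ (by positivity) h2 (i + 1)

/-- **Refined bound for the top derivative of `e^{-J}`**, affine in the top derivative of `J`: if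
`J(z) ≥ 0`, `‖DˡJ(z)‖ ≤ S` for `1 ≤ l ≤ n` (`S ≥ 1`) and `‖Dⁿ⁺¹J(z)‖ ≤ d`, then
`‖Dⁿ⁺¹e^{-J}(z)‖ ≤ d + 2ⁿ S (2ⁿ S)ⁿ`. [folklore] -/
theorem norm_iteratedFDeriv_exp_neg_succ_le (hJ : ContDiff ℝ ∞ J) {z : P} (hJ0 : 0 ≤ J z) {n : ℕ}
    {S d : ℝ} (hS : 1 ≤ S) (hb : ∀ l, 1 ≤ l → l ≤ n → ‖iteratedFDeriv ℝ l J z‖ ≤ S)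
    (hd : ‖iteratedFDeriv ℝ (n + 1) J z‖ ≤ d) :
    ‖iteratedFDeriv ℝ (n + 1) (fun z => Real.exp (-J z)) z‖ ≤ d + 2 ^ n * (S * (2 ^ n * S) ^ n) := by
  have hS0 : 0 ≤ S := zero_le_one.trans hS
  have hcrude := norm_iteratedFDeriv_exp_neg_le hJ hJ0 hS hb
  refine (norm_iteratedFDeriv_exp_neg_succ_le_sum hJ n z).trans ?_
  refine sum_range_succ_le_head_add (by positivity) ?_ fun i h1 hin => ?_
  · -- `i = 0`: `|e^{-J}| ‖Dⁿ⁺¹J‖ ≤ d`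
    rw [Nat.choose_zero_right, Nat.cast_one, one_mul, Nat.sub_zero, norm_iteratedFDeriv_zero,
      Real.norm_eq_abs, abs_of_pos (Real.exp_pos _)]
    calc Real.exp (-J z) * ‖iteratedFDeriv ℝ (n + 1) J z‖ ≤ 1 * ‖iteratedFDeriv ℝ (n + 1) J z‖ :=
          mul_le_mul_of_nonneg_right (Real.exp_le_one_iff.2 (neg_nonpos.2 hJ0)) (norm_nonneg _)
      _ ≤ d := by rw [one_mul]; exact hd
  · have h2 : ‖iteratedFDeriv ℝ i (fun z => Real.exp (-J z)) z‖ ≤ (2 ^ n * S) ^ n := by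
      refine (hcrude i hin).trans ?_
      have h1' : (1 : ℝ) ≤ 2 ^ i * S := one_le_mul_of_one_le_of_one_le (one_le_pow₀ (by norm_num)) hS
      have h2' : (2 : ℝ) ^ i * S ≤ 2 ^ n * S :=
        mul_le_mul_of_nonneg_right (pow_le_pow_right₀ one_le_two hin) hS0
      calc (2 ^ i * S) ^ i ≤ (2 ^ n * S) ^ i := pow_le_pow_left₀ (by positivity) h2' i
        _ ≤ (2 ^ n * S) ^ n := pow_le_pow_right₀ (h1'.trans h2') hin
    have h3 : ‖iteratedFDeriv ℝ (n + 1 - i) J z‖ ≤ S := hb _ (by omega) (by omega)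
    calc (n.choose i : ℝ) * ‖iteratedFDeriv ℝ i (fun z => Real.exp (-J z)) z‖ *
          ‖iteratedFDeriv ℝ (n + 1 - i) J z‖
        ≤ (n.choose i : ℝ) * (2 ^ n * S) ^ n * S := by gcongr
      _ = (n.choose i : ℝ) * (S * (2 ^ n * S) ^ n) := by ring

end Exp

/-! ### The normalising factor `(1 + δ m)⁻¹` -/

section Inv

variable {m : P → ℝ} {δ : ℝ}

/-- `(1 + δ m)⁻¹` is smooth for `m ≥ 0`, `δ ≥ 0`. [folklore] -/
theorem contDiff_inv_one_add (hm : ContDiff ℝ ∞ m) (hδ : 0 ≤ δ) (hm0 : ∀ z, 0 ≤ m z) :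
    ContDiff ℝ ∞ fun z => (1 + δ * m z)⁻¹ :=
  (contDiff_const.add (contDiff_const.mul hm)).inv fun z => by nlinarith [hm0 z]

/-- The derivative of `(1 + δ m)⁻¹` is `(-δ (1 + δ m)⁻²) • Dm`. [folklore] -/
theorem fderiv_inv_one_add (hm : ContDiff ℝ ∞ m) (hδ : 0 ≤ δ) (hm0 : ∀ z, 0 ≤ m z) (z : P) :
    fderiv ℝ (fun z => (1 + δ * m z)⁻¹) z =
      (-δ * ((1 + δ * m z)⁻¹) ^ 2) • fderiv ℝ m z := by
  have hne : 1 + δ * m z ≠ 0 := by nlinarith [hm0 z]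
  have hdm : HasFDerivAt m (fderiv ℝ m z) z := (hm.differentiable (by simp) z).hasFDerivAt
  have hd1 : HasFDerivAt (fun z => 1 + δ * m z) (δ • fderiv ℝ m z) z := by
    have := (hdm.const_smul δ).const_add 1
    simpa only [Pi.smul_apply, smul_eq_mul] using this
  have h := (hasFDerivAt_inv hne).comp z hd1
  rw [show (fun z => (1 + δ * m z)⁻¹) = (fun x : ℝ => x⁻¹) ∘ fun z => 1 + δ * m z from rfl, h.fderiv]
  ext v
  simp only [ContinuousLinearMap.coe_comp, comp_apply, smul_apply,
    ContinuousLinearMap.toSpanSingleton_apply, smul_eq_mul, inv_pow]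
  ring

/-- One-step recursion for `N = (1 + δ m)⁻¹`:
`‖Dⁿ⁺¹N(z)‖ ≤ ∑ᵢ C(n,i) (δ ‖Dⁱ(N²)(z)‖) ‖Dⁿ⁺¹⁻ⁱm(z)‖`. [folklore] -/
theorem norm_iteratedFDeriv_inv_one_add_succ_le_sum (hm : ContDiff ℝ ∞ m) (hδ : 0 ≤ δ)
    (hm0 : ∀ z, 0 ≤ m z) (n : ℕ) (z : P) :
    ‖iteratedFDeriv ℝ (n + 1) (fun z => (1 + δ * m z)⁻¹) z‖ ≤ ∑ i ∈ range (n + 1),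
      (n.choose i : ℝ) * (δ * ‖iteratedFDeriv ℝ i (fun z => ((1 + δ * m z)⁻¹) ^ 2) z‖) *
        ‖iteratedFDeriv ℝ (n + 1 - i) m z‖ := by
  have hN := contDiff_inv_one_add hm hδ hm0
  have hψ : ContDiff ℝ ∞ fun z => -δ * ((1 + δ * m z)⁻¹) ^ 2 := contDiff_const.mul (hN.pow 2)
  have h := norm_iteratedFDeriv_succ_le_of_fderiv_eq_smul (Φ := fun z => (1 + δ * m z)⁻¹) hψ hm
    (fderiv_inv_one_add hm hδ hm0) n z
  refine h.trans (le_of_eq (sum_congr rfl fun i hi => ?_))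
  congr 2
  have hlt : (i : ℕ∞ω) ≤ ∞ := by exact_mod_cast le_top
  have e : (fun z => -δ * ((1 + δ * m z)⁻¹) ^ 2) = fun z => (-δ) • ((1 + δ * m z)⁻¹) ^ 2 := rfl
  rw [e, iteratedFDeriv_const_smul_apply' ((hN.pow 2).of_le hlt).contDiffAt, norm_smul,
    Real.norm_eq_abs, abs_neg, abs_of_nonneg hδ]

/-- Leibniz for the square: `‖Dⁱ(N²)(z)‖ ≤ 2ⁱ B²` if `‖DʲN(z)‖ ≤ B` for `j ≤ i`. [folklore] -/
theorem norm_iteratedFDeriv_sq_le {N : P → ℝ} (hN : ContDiff ℝ ∞ N) {i : ℕ} {B : ℝ} {z : P}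
    (hB : ∀ j ≤ i, ‖iteratedFDeriv ℝ j N z‖ ≤ B) :
    ‖iteratedFDeriv ℝ i (fun z => N z ^ 2) z‖ ≤ 2 ^ i * B * B := by
  have e : (fun z => N z ^ 2) = fun z => N z * N z := funext fun z => sq (N z)
  rw [e]
  refine (norm_iteratedFDeriv_mul_le hN hN z (mod_cast le_top)).trans ?_
  exact sum_choose_mul_le (fun j _ => norm_nonneg _) hB (fun j _ => norm_nonneg _) hB

/-- **Crude bound for the derivatives of `(1 + δ m)⁻¹`.** If `m ≥ 0`, `δ ≥ 0`,
`‖Dˡm(z)‖ ≤ S` for `1 ≤ l ≤ n`, `S ≥ 1`, then with `Θ = 4ⁿ max(δ,1) S`,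
`‖Dⁱ(1 + δ m)⁻¹(z)‖ ≤ Θ^(2ⁱ - 1)` for all `i ≤ n`. [folklore] -/
theorem norm_iteratedFDeriv_inv_one_add_le (hm : ContDiff ℝ ∞ m) (hδ : 0 ≤ δ)
    (hm0 : ∀ z, 0 ≤ m z) {z : P} {n : ℕ} {S : ℝ} (hS : 1 ≤ S)
    (hb : ∀ l, 1 ≤ l → l ≤ n → ‖iteratedFDeriv ℝ l m z‖ ≤ S) :
    ∀ i ≤ n, ‖iteratedFDeriv ℝ i (fun z => (1 + δ * m z)⁻¹) z‖ ≤
      (4 ^ n * max δ 1 * S) ^ (2 ^ i - 1) := by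
  set Θ : ℝ := 4 ^ n * max δ 1 * S with hΘ
  have hS0 : 0 ≤ S := zero_le_one.trans hS
  have hΘ1 : 1 ≤ Θ := by
    rw [hΘ]
    exact one_le_mul_of_one_le_of_one_le (one_le_mul_of_one_le_of_one_le
      (one_le_pow₀ (by norm_num)) (le_max_right _ _)) hS
  have hΘ0 : 0 ≤ Θ := zero_le_one.trans hΘ1
  have hN := contDiff_inv_one_add hm hδ hm0
  have hNz : ∀ y, 0 < (1 + δ * m y)⁻¹ := fun y => inv_pos.2 (by nlinarith [hm0 y])
  have hNle : ∀ y, (1 + δ * m y)⁻¹ ≤ 1 := fun y => inv_le_one_of_one_le₀ (by nlinarith [hm0 y])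
  suffices H : ∀ i ≤ n, ∀ j ≤ i, ‖iteratedFDeriv ℝ j (fun z => (1 + δ * m z)⁻¹) z‖ ≤
      Θ ^ (2 ^ i - 1) from fun i hi => H i hi i le_rfl
  intro i
  induction i with
  | zero =>
    intro _ j hj
    rw [Nat.le_zero.1 hj, norm_iteratedFDeriv_zero, Real.norm_eq_abs, abs_of_pos (hNz z)]
    simpa using hNle z
  | succ i ih =>
    intro hi j hj
    have hi' : i ≤ n := (Nat.le_succ i).trans hi
    have hmono : Θ ^ (2 ^ i - 1) ≤ Θ ^ (2 ^ (i + 1) - 1) :=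
      pow_le_pow_right₀ hΘ1 (Nat.sub_le_sub_right (Nat.pow_le_pow_right (by norm_num)
        (Nat.le_succ i)) 1)
    rcases Nat.lt_or_ge j (i + 1) with hlt | hge
    · exact (ih hi' j (Nat.lt_succ_iff.1 hlt)).trans hmono
    · have hji : j = i + 1 := le_antisymm hj hge
      subst hji
      refine (norm_iteratedFDeriv_inv_one_add_succ_le_sum hm hδ hm0 i z).trans ?_
      -- bound the factors `δ ‖Dʲ(N²)‖ ≤ δ 2ⁱ (Θ^(2ⁱ-1))²` and `‖D^{i+1-j} m‖ ≤ S`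
      have hsq : ∀ j ≤ i, δ * ‖iteratedFDeriv ℝ j (fun z => ((1 + δ * m z)⁻¹) ^ 2) z‖ ≤
          δ * (2 ^ i * Θ ^ (2 ^ i - 1) * Θ ^ (2 ^ i - 1)) := by
        intro j hj
        refine mul_le_mul_of_nonneg_left ?_ hδ
        refine (norm_iteratedFDeriv_sq_le hN (fun a ha => ih hi' a (ha.trans hj))).trans ?_
        have hB0 : 0 ≤ Θ ^ (2 ^ i - 1) := pow_nonneg hΘ0 _
        exact mul_le_mul_of_nonneg_right (mul_le_mul_of_nonneg_right
          (pow_le_pow_right₀ one_le_two hj) hB0) hB0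
      have hsum := sum_choose_mul_le (n := i)
        (x := fun j => δ * ‖iteratedFDeriv ℝ j (fun z => ((1 + δ * m z)⁻¹) ^ 2) z‖)
        (y := fun j => ‖iteratedFDeriv ℝ (j + 1) m z‖)
        (X := δ * (2 ^ i * Θ ^ (2 ^ i - 1) * Θ ^ (2 ^ i - 1))) (Y := S)
        (fun j _ => mul_nonneg hδ (norm_nonneg _)) hsq (fun j _ => norm_nonneg _)
        (fun j hj => hb (j + 1) (Nat.le_add_left _ _) (by omega))
      have hrw : ∀ j ∈ range (i + 1), (i.choose j : ℝ) *
          (δ * ‖iteratedFDeriv ℝ j (fun z => ((1 + δ * m z)⁻¹) ^ 2) z‖) *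
            ‖iteratedFDeriv ℝ (i + 1 - j) m z‖ = (i.choose j : ℝ) *
          (δ * ‖iteratedFDeriv ℝ j (fun z => ((1 + δ * m z)⁻¹) ^ 2) z‖) *
            ‖iteratedFDeriv ℝ (i - j + 1) m z‖ := by
        intro j hj
        rw [Nat.sub_add_comm (Nat.lt_succ_iff.1 (mem_range.1 hj))]
      rw [sum_congr rfl hrw]
      refine hsum.trans ?_
      -- `2ⁱ · δ 2ⁱ Θ^(2ⁱ-1) Θ^(2ⁱ-1) · S ≤ Θ · Θ^(2·2ⁱ-2) = Θ^(2^{i+1}-1)`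
      have hδle : δ ≤ max δ 1 := le_max_left _ _
      have h4 : (2 : ℝ) ^ i * 2 ^ i = 4 ^ i := by rw [← mul_pow]; norm_num
      have hcoef : (2 : ℝ) ^ i * (δ * (2 ^ i)) * S ≤ Θ := by
        calc (2 : ℝ) ^ i * (δ * 2 ^ i) * S = 4 ^ i * δ * S := by rw [← h4]; ring
          _ ≤ 4 ^ n * max δ 1 * S := by
              gcongr
              · norm_num
          _ = Θ := rfl
      have hexp : Θ * (Θ ^ (2 ^ i - 1) * Θ ^ (2 ^ i - 1)) = Θ ^ (2 ^ (i + 1) - 1) := by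
        rw [← pow_add, ← pow_succ']
        congr 1
        have h1 : 1 ≤ 2 ^ i := Nat.one_le_two_pow
        rw [pow_succ]; omega
      calc (2 : ℝ) ^ i * (δ * (2 ^ i * Θ ^ (2 ^ i - 1) * Θ ^ (2 ^ i - 1))) * S
          = (2 ^ i * (δ * 2 ^ i) * S) * (Θ ^ (2 ^ i - 1) * Θ ^ (2 ^ i - 1)) := by ring
        _ ≤ Θ * (Θ ^ (2 ^ i - 1) * Θ ^ (2 ^ i - 1)) :=
            mul_le_mul_of_nonneg_right hcoef (by positivity)
        _ = Θ ^ (2 ^ (i + 1) - 1) := hexp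

/-- **Refined bound for the top derivative of `(1 + δ m)⁻¹`**, affine in the top derivative of
`m`: under the hypotheses of `norm_iteratedFDeriv_inv_one_add_le` and `‖Dⁿ⁺¹m(z)‖ ≤ d`,
`‖Dⁿ⁺¹(1 + δ m)⁻¹(z)‖ ≤ δ d + 2ⁿ (δ 2ⁿ Θ^(2ⁿ-1) Θ^(2ⁿ-1) S)`, `Θ = 4ⁿ max(δ,1) S`. [folklore] -/
theorem norm_iteratedFDeriv_inv_one_add_succ_le (hm : ContDiff ℝ ∞ m) (hδ : 0 ≤ δ)
    (hm0 : ∀ z, 0 ≤ m z) {z : P} {n : ℕ} {S d : ℝ} (hS : 1 ≤ S)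
    (hb : ∀ l, 1 ≤ l → l ≤ n → ‖iteratedFDeriv ℝ l m z‖ ≤ S)
    (hd : ‖iteratedFDeriv ℝ (n + 1) m z‖ ≤ d) :
    ‖iteratedFDeriv ℝ (n + 1) (fun z => (1 + δ * m z)⁻¹) z‖ ≤
      δ * d + 2 ^ n * (δ * (2 ^ n * (4 ^ n * max δ 1 * S) ^ (2 ^ n - 1) *
        (4 ^ n * max δ 1 * S) ^ (2 ^ n - 1)) * S) := by
  set Θ : ℝ := 4 ^ n * max δ 1 * S with hΘ
  have hS0 : 0 ≤ S := zero_le_one.trans hS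
  have hN := contDiff_inv_one_add hm hδ hm0
  have hcrude := norm_iteratedFDeriv_inv_one_add_le hm hδ hm0 (z := z) hS hb
  have hNz : 0 < (1 + δ * m z)⁻¹ := inv_pos.2 (by nlinarith [hm0 z])
  have hNle : (1 + δ * m z)⁻¹ ≤ 1 := inv_le_one_of_one_le₀ (by nlinarith [hm0 z])
  have hΘ0 : 0 ≤ Θ := by rw [hΘ]; positivity
  refine (norm_iteratedFDeriv_inv_one_add_succ_le_sum hm hδ hm0 n z).trans ?_
  refine sum_range_succ_le_head_add (by positivity) ?_ fun i h1 hin => ?_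
  · -- `i = 0`: `δ N² ‖Dⁿ⁺¹m‖ ≤ δ d`
    rw [Nat.choose_zero_right, Nat.cast_one, one_mul, Nat.sub_zero, norm_iteratedFDeriv_zero,
      Real.norm_eq_abs, abs_of_pos (pow_pos hNz 2)]
    have hsq1 : ((1 + δ * m z)⁻¹) ^ 2 ≤ 1 := pow_le_one₀ hNz.le hNle
    calc δ * (1 + δ * m z)⁻¹ ^ 2 * ‖iteratedFDeriv ℝ (n + 1) m z‖ ≤ δ * 1 * d := by gcongr
      _ = δ * d := by ring
  · have hΘ1 : (1 : ℝ) ≤ Θ := by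
      rw [hΘ]
      exact one_le_mul_of_one_le_of_one_le (one_le_mul_of_one_le_of_one_le
        (one_le_pow₀ (by norm_num)) (le_max_right _ _)) hS
    have hB0 : 0 ≤ Θ ^ (2 ^ n - 1) := pow_nonneg hΘ0 _
    have hsq : ‖iteratedFDeriv ℝ i (fun z => ((1 + δ * m z)⁻¹) ^ 2) z‖ ≤
        2 ^ n * Θ ^ (2 ^ n - 1) * Θ ^ (2 ^ n - 1) := by
      refine (norm_iteratedFDeriv_sq_le hN (B := Θ ^ (2 ^ n - 1)) (fun a ha => ?_)).trans ?_
      · exact (hcrude a (ha.trans hin)).trans (pow_le_pow_right₀ hΘ1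
          (Nat.sub_le_sub_right (Nat.pow_le_pow_right (by norm_num) (ha.trans hin)) 1))
      · exact mul_le_mul_of_nonneg_right (mul_le_mul_of_nonneg_right
          (pow_le_pow_right₀ one_le_two hin) hB0) hB0
    have h3 : ‖iteratedFDeriv ℝ (n + 1 - i) m z‖ ≤ S := hb _ (by omega) (by omega)
    calc (n.choose i : ℝ) * (δ * ‖iteratedFDeriv ℝ i (fun z => ((1 + δ * m z)⁻¹) ^ 2) z‖) *
          ‖iteratedFDeriv ℝ (n + 1 - i) m z‖
        ≤ (n.choose i : ℝ) * (δ * (2 ^ n * Θ ^ (2 ^ n - 1) * Θ ^ (2 ^ n - 1))) * S := by gcongr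
      _ = (n.choose i : ℝ) * (δ * (2 ^ n * Θ ^ (2 ^ n - 1) * Θ ^ (2 ^ n - 1)) * S) := by ring

end Inv

end Literature.Analysis.Calculus

end
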